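import Mathlib.Algebra.Polynomial.Derivative
import Literature.MathematicalPhysics.QuantumFieldTheory.OneCharacterExpansion
import Literature.MathematicalPhysics.QuantumLattice.LatticeTori
import HarnessLib

/-!
# Venture YMGap, track (b) census — the one-character twist census OBJECTS on a RECTANGULAR torus
# `L₀ × L₁ × ⋯ × L_{d-1}`: plaquettes, holonomies, `Z`, `Z⁻_V`, their character-expansion polynomials in
# `s = c_{1/2}`, and the census polynomial `N_V = (Z⁻_V)′ Z − Z⁻_V Z′` — DEFINITIONS (+ the expansion theorem)

HONEST FRAMING: venture file of the cell `pub-ymgap` (QuantumFields programme), track (b) (exact small-volume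
census).  Finite tori and the ONE-CHARACTER (`J = 1`, spin `1/2` only) truncated `SU(2)` model
`f(U) = 1 + 2 s χ_{1/2}(U)` only; nothing here is about the Wilson action, a truncation tail, a limit,
confinement or a mass gap.  This file ASSERTS NO LAW: it supplies the objects over which
`Conjectures/TwistCensusParity.lean` types the census laws (P)(G)(D)(S∞) of HOME/STRUCTURE.md §2 C-1, and
proves only algebraic identities (the character expansion, constant-sides reductions).

Why a new file: the tree's vocabulary (`ConstructiveQFTWave0`: `Site d L`, `Plaquette d L`, `plaquetteHolonomy`;
`TomboulisVortexDecimation`: `torusZ`, `torusZtw`, `vortexSheet`; `OneCharacterExpansion`: `charMoment`,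
`torusZtw_one_eq_sum`) is the CUBIC torus `(ℤ/Lℤ)^d`, while 125 of the 127 census rows of record live on
rectangular tori `2²×L`, `2×3×L`, `2×4×L`, `3²×L` (HOME/engine/census/TM-RESULTS.md).  Everything below repeats
that vocabulary verbatim for the side vector `Ls : Fin d → ℕ` on the tree's rectangular torus
`RectTorusSite Ls = Π i, ℤ/(Ls i)` (`Literature/MathematicalPhysics/QuantumLattice/LatticeTori.lean`; links as in
`FlowData/RectSliceKernel.lean`), and on constant sides `Ls = fun _ => L` each object IS the cubic one
definitionally (`rectTorusZ_const`, `rectTorusZtw_const`, `rectVortexSheet_const`, `rectCharMoment_const`).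

## Dictionary (engine-1 census, HOME/engine/census/TM-RESULTS.md header; Tomboulis arXiv:0707.2179 §§2, 4, 6)
* `RectEdge Ls = RectTorusSite Ls × Fin d` (link `(x, i)` from `x` to `x + eᵢ`), `RectPlaquette Ls =
  RectTorusSite Ls × {(i, j) // i < j}`, `rectPlaquetteHolonomy U x i j = U(x,i) U(x+eᵢ,j) U(x+eⱼ,i)⁻¹ U(x,j)⁻¹`.
* `rectTorusZ Ls J c = ∫ ∏_p f(U_p)`, `rectTorusZtw Ls J c V = ∫ ∏_{p∉V} f(U_p) ∏_{p∈V} f(−U_p)` with Tomboulis's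
  `plaqFn` / `plaqFnTwist` (normalised Haar measure on every link); `rectVortexSheet Ls i j` = the coclosed
  twist stack `𝒱_{ij}` = all `(i, j)`-plaquettes based at `x_i = x_j = 0` (`|𝒱_{ij}| = ∏_{k ≠ i, j} L_k`; in
  `d = 3` with `(i, j, ρ)` a permutation of the axes, `|𝒱_{ij}| = L_ρ` = the number of `(i, j)`-SHEETS).
* One-character ray: cut-off `J = 1` and the constant coefficient vector `oneCharCoeff s = fun _ => s` (only
  `c 1 = c_{1/2} = s` enters at `J = 1`): `f = 1 + 2 s χ_{1/2}`, `f⁻ = 1 − 2 s χ_{1/2}` (`plaqFn_one`,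
  `plaqFnTwist_one`).  `oneCharZ Ls s`, `oneCharZtw Ls V s`, and the census function
  `oneCharN Ls V s = (d/ds Z⁻_V) · Z − Z⁻_V · (d/ds Z)` (so `d/ds (Z⁻_V/Z) = N_V / Z²`: Tomboulis's (5.24) on
  the ray at `s` is `N_V(s) ≤ 0`).
* Character expansion (OneCharacterExpansion for the cubic torus; `rectTorusZtw_one_eq_sum` here):
  `Z⁻_V(s) = Σ_{S ⊆ plaquettes} (2s)^{|S|} (−1)^{|S ∩ V|} I(S)`, `I(S) = rectCharMoment Ls S = ∫ ∏_{p∈S} χ_{1/2}(U_p)`.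
  The same sums read as POLYNOMIALS in `s`: `oneCharZPoly`, `oneCharZtwPoly`, and
  `twistCensusPoly Ls V := (oneCharZtwPoly)′ · oneCharZPoly − oneCharZtwPoly · (oneCharZPoly)′ ∈ ℝ[X]` — the
  exact object the census engines compute (integer coefficients after scaling) and on which the laws are
  decided by Sturm / Descartes / VCA certificates; `twistCensusPoly_eval` identifies its values with `oneCharN`.
  (The sign-change count `positiveSignChanges` and its parity lemma are in `Census/PositiveSignChanges.lean`.)

References: E. T. Tomboulis, arXiv:0707.2179 §2 (2.5), §4 (4.2)–(4.4), §5 (5.24), §6 (6.2)–(6.4)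
[cite: Tomboulis2007Confinement, §6 eqs. (6.2)–(6.4)]; cell files HOME/engine/census/{TM-RESULTS.md,
C5_ray_Jhalf_single-lattice.md}, HOME/STRUCTURE.md §2 C-1 / §4 N-3.
-/

noncomputable section

open MeasureTheory Finset Real Polynomial
open scoped BigOperators
open Literature.MathematicalPhysics.QuantumLattice
open Literature.MathematicalPhysics.QuantumFieldTheory
open Literature.MathematicalPhysics.QuantumFieldTheory.Tomboulis2007

namespace Summit.Ventures.YMGap.Census

variable {d : ℕ}

/-! ### Rectangular-torus gauge vocabulary (verbatim copies of `ConstructiveQFTWave0` §S11 with `Site d L ↦ RectTorusSite Ls`) -/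

/-- Positively oriented links of the rectangular torus `Π_i ℤ/(Ls i)`: `(x, i)` is the link from `x` to `x + eᵢ`
(as in `FlowData/RectSliceKernel.RectSlice`). -/
abbrev RectEdge (Ls : Fin d → ℕ) : Type := RectTorusSite Ls × Fin d

/-- Plaquettes of the rectangular torus: `(x, ⟨(i, j), i < j⟩)` is the unit square at `x` spanned by `eᵢ, eⱼ`. -/
abbrev RectPlaquette (Ls : Fin d → ℕ) : Type := RectTorusSite Ls × {p : Fin d × Fin d // p.1 < p.2}

/-- Gauge configurations on the rectangular torus: a group element on every positively oriented link. -/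
abbrev RectGaugeConfig (Ls : Fin d → ℕ) (G : Type*) : Type _ := RectEdge Ls → G

/-- Plaquette holonomy `U_p = U(x,i) U(x+eᵢ,j) U(x+eⱼ,i)⁻¹ U(x,j)⁻¹` on the rectangular torus (the cubic
`plaquetteHolonomy` with `Site.shift x i = x + Pi.single i 1` written out). -/
def rectPlaquetteHolonomy {Ls : Fin d → ℕ} {G : Type*} [Group G] (U : RectGaugeConfig Ls G)
    (x : RectTorusSite Ls) (i j : Fin d) : G :=
  U (x, i) * U (x + Pi.single i 1, j) * (U (x + Pi.single j 1, i))⁻¹ * (U (x, j))⁻¹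

section PlaqChar

variable {Ls : Fin d → ℕ}

/-- The fundamental character of a plaquette holonomy, `χ_{1/2}(U_p) = tr U_p` (cubic: `plaqChar`). -/
def rectPlaqChar (U : RectGaugeConfig Ls SU2) (p : RectPlaquette Ls) : ℝ :=
  su2Char 1 (rectPlaquetteHolonomy U p.1 p.2.1.1 p.2.1.2)

/-- `χ_{1/2}(U_p) = Re tr U_p` (plumbing). -/
private theorem rectPlaqChar_eq (U : RectGaugeConfig Ls SU2) (p : RectPlaquette Ls) :
    rectPlaqChar U p = ((fundamentalRep (Fin 2) (rectPlaquetteHolonomy U p.1 p.2.1.1 p.2.1.2)).trace).re := by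
  simp only [rectPlaqChar, su2Char, fundamentalRep_apply, Nat.cast_one, Polynomial.Chebyshev.U_one,
    Polynomial.eval_mul, Polynomial.eval_ofNat, Polynomial.eval_X]
  ring

/-- The plaquette character is measurable for the product σ-algebra (plumbing, via `WilsonRP.EntryMeasurable`). -/
private theorem measurable_rectPlaqChar (p : RectPlaquette Ls) :
    Measurable fun U : RectGaugeConfig Ls SU2 => rectPlaqChar U p := by
  have h : (fun U : RectGaugeConfig Ls SU2 => rectPlaqChar U p) = fun U =>
      ((fundamentalRep (Fin 2) (rectPlaquetteHolonomy U p.1 p.2.1.1 p.2.1.2)).trace).re :=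
    funext fun U => rectPlaqChar_eq U p
  rw [h]
  have hρ := continuous_fundamentalRep (Fin 2)
  unfold rectPlaquetteHolonomy
  exact ((((WilsonRP.entryMeasurable_apply hρ _).mul (WilsonRP.entryMeasurable_apply hρ _)).mul
    (WilsonRP.entryMeasurable_apply_inv hρ _)).mul (WilsonRP.entryMeasurable_apply_inv hρ _)).measurable_trace_re

/-- `|χ_{1/2}(U_p)| ≤ 2` (plumbing). -/
private theorem abs_rectPlaqChar_le (U : RectGaugeConfig Ls SU2) (p : RectPlaquette Ls) : |rectPlaqChar U p| ≤ 2 := by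
  rw [rectPlaqChar_eq]
  exact_mod_cast Literature.RepresentationTheory.CompactGroups.CompactGroup.abs_re_trace_le_card
    (fundamentalRep (Fin 2)) (continuous_fundamentalRep (Fin 2)) _

end PlaqChar

variable (Ls : Fin d → ℕ) [∀ i, NeZero (Ls i)]

/-- **Tomboulis's normalised partition function on the rectangular torus**, `Z_Λ({c_j}) = ∫ ∏_p f(U_p) ∏_b dU_b`
with spin cut-off `J` (the cubic `torusZ` verbatim). [cite: Tomboulis2007Confinement, §2 eq. (2.7)] -/
def rectTorusZ (J : ℕ) (c : ℕ → ℝ) : ℝ :=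
  ∫ U, ∏ p : RectPlaquette Ls, plaqFn J c (rectPlaquetteHolonomy U p.1 p.2.1.1 p.2.1.2)
    ∂(Measure.pi fun _ : RectEdge Ls => haarProbability SU2)

/-- **The twisted partition function on the rectangular torus** `Z⁻_Λ`: `f(U_p) ↦ f(−U_p)` on the plaquettes of `V`
(the cubic `torusZtw` verbatim). [cite: Tomboulis2007Confinement, §4 eqs. (4.4)–(4.5)] -/
def rectTorusZtw (J : ℕ) (c : ℕ → ℝ) (V : Finset (RectPlaquette Ls)) : ℝ :=
  ∫ U, ∏ p : RectPlaquette Ls,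
      (if p ∈ V then plaqFnTwist J c (rectPlaquetteHolonomy U p.1 p.2.1.1 p.2.1.2)
        else plaqFn J c (rectPlaquetteHolonomy U p.1 p.2.1.1 p.2.1.2))
    ∂(Measure.pi fun _ : RectEdge Ls => haarProbability SU2)

/-- **The twist stack `𝒱_{ij}` of the rectangular torus**: all `(i, j)`-plaquettes whose base point has vanishing
`i`- and `j`-coordinates — coclosed, winding in the `d − 2` perpendicular directions, `∏_{k ≠ i,j} L_k` plaquettes
(the cubic `vortexSheet` verbatim; the engines' "twist plane `(i, j)`"). [cite: Tomboulis2007Confinement, §4 (the set 𝒱_{μν})] -/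
def rectVortexSheet (i j : Fin d) (hij : i < j) : Finset (RectPlaquette Ls) :=
  univ.filter fun p => p.2 = ⟨(i, j), hij⟩ ∧ p.1 i = 0 ∧ p.1 j = 0

/-- On constant sides the rectangular partition function IS the cubic `torusZ` (definitionally). -/
theorem rectTorusZ_const (L : ℕ) [NeZero L] (J : ℕ) (c : ℕ → ℝ) :
    rectTorusZ (fun _ : Fin d => L) J c = torusZ d L J c := rfl

/-- On constant sides the rectangular twisted partition function IS the cubic `torusZtw` (definitionally). -/
theorem rectTorusZtw_const (L : ℕ) [NeZero L] (J : ℕ) (c : ℕ → ℝ) (V : Finset (Plaquette d L)) :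
    rectTorusZtw (fun _ : Fin d => L) J c V = torusZtw d L J c V := rfl

/-- On constant sides the rectangular twist stack IS Tomboulis's `vortexSheet` (definitionally). -/
theorem rectVortexSheet_const (L : ℕ) [NeZero L] (i j : Fin d) (hij : i < j) :
    rectVortexSheet (fun _ : Fin d => L) i j hij = vortexSheet L i j hij := rfl

/-! ### The one-character ray -/

/-- The coefficient vector of the one-character ray: every `c_j = s`; with cut-off `J = 1` only `c_{1/2} = c 1 = s`
enters, `f = 1 + 2 s χ_{1/2}` (`plaqFn_one`). -/
def oneCharCoeff (s : ℝ) : ℕ → ℝ := fun _ => s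

/-- `Z(s)` of the one-character model `f = 1 + 2 s χ_{1/2}` on the rectangular torus. -/
def oneCharZ (s : ℝ) : ℝ := rectTorusZ Ls 1 (oneCharCoeff s)

/-- `Z⁻_V(s)` of the one-character model, twist on `V`. -/
def oneCharZtw (V : Finset (RectPlaquette Ls)) (s : ℝ) : ℝ := rectTorusZtw Ls 1 (oneCharCoeff s) V

/-- **The census function** `N_V(s) = (d/ds Z⁻_V)·Z − Z⁻_V·(d/ds Z)` (so that `d/ds (Z⁻_V/Z) = N_V/Z²`; Tomboulis's
(5.24) along the one-character ray at `s` reads `N_V(s) ≤ 0`). -/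
def oneCharN (V : Finset (RectPlaquette Ls)) (s : ℝ) : ℝ :=
  deriv (oneCharZtw Ls V) s * oneCharZ Ls s - oneCharZtw Ls V s * deriv (oneCharZ Ls) s

/-! ### Haar moments and the character-expansion polynomials -/

/-- **The Haar moment of a plaquette set** `I(S) = ∫ ∏_{p ∈ S} χ_{1/2}(U_p) ∏_b dU_b` (cubic: `charMoment`;
Tomboulis's unnormalised activity (6.2) on the one-character ray). [cite: Tomboulis2007Confinement, §6 eq. (6.2)] -/
def rectCharMoment (S : Finset (RectPlaquette Ls)) : ℝ :=
  ∫ U, ∏ p ∈ S, rectPlaqChar U p ∂(Measure.pi fun _ : RectEdge Ls => haarProbability SU2)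

/-- On constant sides the rectangular Haar moment IS the cubic `charMoment` (definitionally). -/
theorem rectCharMoment_const (L : ℕ) [NeZero L] (S : Finset (Plaquette d L)) :
    rectCharMoment (fun _ : Fin d => L) S = charMoment S := rfl

/-- **`Z` as a polynomial in `s = c_{1/2}`**: `Σ_{S ⊆ plaquettes} 2^{|S|} I(S) X^{|S|}`. -/
def oneCharZPoly : ℝ[X] :=
  ∑ S ∈ (univ : Finset (RectPlaquette Ls)).powerset, C ((2 : ℝ) ^ S.card * rectCharMoment Ls S) * X ^ S.card

/-- **`Z⁻_V` as a polynomial in `s`**: `Σ_S 2^{|S|} (−1)^{|S ∩ V|} I(S) X^{|S|}`. -/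
def oneCharZtwPoly (V : Finset (RectPlaquette Ls)) : ℝ[X] :=
  ∑ S ∈ (univ : Finset (RectPlaquette Ls)).powerset,
    C ((2 : ℝ) ^ S.card * (-1 : ℝ) ^ (S ∩ V).card * rectCharMoment Ls S) * X ^ S.card

/-- **THE CENSUS POLYNOMIAL** `N_V = (Z⁻_V)′ · Z − Z⁻_V · Z′ ∈ ℝ[X]` of the twist `V` — the object whose lowest term,
degree, leading sign and positive sign changes the census rows record (HOME/engine/census/TM_C5_rows*.jsonl). -/
def twistCensusPoly (V : Finset (RectPlaquette Ls)) : ℝ[X] :=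
  derivative (oneCharZtwPoly Ls V) * oneCharZPoly Ls - oneCharZtwPoly Ls V * derivative (oneCharZPoly Ls)

/-! ### The character expansion on the rectangular torus (proof = `OneCharacterExpansion.torusZtw_one_eq_sum` verbatim) -/

/-- Products of plaquette characters are Haar integrable (bounded by `2^{|S|}`, measurable). -/
private theorem integrable_prod_rectPlaqChar (S : Finset (RectPlaquette Ls)) :
    Integrable (fun U : RectGaugeConfig Ls SU2 => ∏ p ∈ S, rectPlaqChar U p)
      (Measure.pi fun _ : RectEdge Ls => haarProbability SU2) := by
  have hmeas : Measurable fun U : RectGaugeConfig Ls SU2 => ∏ p ∈ S, rectPlaqChar U p :=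
    Finset.measurable_prod S fun p _ => measurable_rectPlaqChar p
  refine Integrable.of_mem_Icc (-(2 : ℝ) ^ S.card) ((2 : ℝ) ^ S.card) hmeas.aemeasurable
    (ae_of_all _ fun U => ?_)
  have hb : |∏ p ∈ S, rectPlaqChar U p| ≤ (2 : ℝ) ^ S.card := by
    rw [Finset.abs_prod, ← Finset.prod_const]
    exact Finset.prod_le_prod (fun p _ => abs_nonneg _) fun p _ => abs_rectPlaqChar_le U p
  exact Set.mem_Icc.mpr (abs_le.mp hb)

omit [∀ i, NeZero (Ls i)] in
/-- The product of the twist signs over `S` is `(−1)^{|S ∩ V|}` (plumbing). -/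
private theorem prod_twistSign' (V S : Finset (RectPlaquette Ls)) :
    ∏ p ∈ S, (if p ∈ V then (-1 : ℝ) else 1) = (-1 : ℝ) ^ (S ∩ V).card := by
  rw [Finset.prod_ite, Finset.prod_const_one, mul_one, Finset.prod_const, Finset.filter_mem_eq_inter]

/-- **The character expansion of `Z⁻_V` on the one-character ray, rectangular torus**:
`Z⁻_V = Σ_{S ⊆ plaquettes} (2 c_{1/2})^{|S|} (−1)^{|S ∩ V|} I(S)` (arXiv:0707.2179 §6 (6.2)–(6.4) with the flux
replacement (4.4); the cubic case is `OneCharacterExpansion.torusZtw_one_eq_sum`). [cite: Tomboulis2007Confinement, §6 eqs. (6.2)–(6.4)] -/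
theorem rectTorusZtw_one_eq_sum (c : ℕ → ℝ) (V : Finset (RectPlaquette Ls)) :
    rectTorusZtw Ls 1 c V = ∑ S ∈ (univ : Finset (RectPlaquette Ls)).powerset,
      (2 * c 1) ^ S.card * (-1 : ℝ) ^ (S ∩ V).card * rectCharMoment Ls S := by
  have hpt : ∀ U : RectGaugeConfig Ls SU2,
      (∏ p : RectPlaquette Ls, (if p ∈ V then plaqFnTwist 1 c (rectPlaquetteHolonomy U p.1 p.2.1.1 p.2.1.2)
        else plaqFn 1 c (rectPlaquetteHolonomy U p.1 p.2.1.1 p.2.1.2))) =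
      ∑ S ∈ (univ : Finset (RectPlaquette Ls)).powerset,
        ((2 * c 1) ^ S.card * (-1 : ℝ) ^ (S ∩ V).card) * ∏ p ∈ S, rectPlaqChar U p := by
    intro U
    have h1 : (∏ p : RectPlaquette Ls, (if p ∈ V then plaqFnTwist 1 c (rectPlaquetteHolonomy U p.1 p.2.1.1 p.2.1.2)
        else plaqFn 1 c (rectPlaquetteHolonomy U p.1 p.2.1.1 p.2.1.2))) =
        ∏ p : RectPlaquette Ls, (1 + (if p ∈ V then (-1 : ℝ) else 1) * (2 * c 1) * rectPlaqChar U p) := by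
      refine Finset.prod_congr rfl fun p _ => ?_
      unfold rectPlaqChar
      split_ifs
      · rw [plaqFnTwist_one]; ring
      · rw [plaqFn_one]; ring
    rw [h1, Finset.prod_one_add]
    refine Finset.sum_congr rfl fun S _ => ?_
    rw [Finset.prod_mul_distrib, Finset.prod_mul_distrib, prod_twistSign', Finset.prod_const]
    ring
  unfold rectTorusZtw
  simp_rw [hpt]
  rw [integral_finsetSum _ (fun S _ => (integrable_prod_rectPlaqChar Ls S).const_mul _)]
  refine Finset.sum_congr rfl fun S _ => ?_
  rw [integral_const_mul]
  rfl

/-- `Z` is `Z⁻` with the empty twist. -/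
theorem rectTorusZtw_empty (J : ℕ) (c : ℕ → ℝ) : rectTorusZtw Ls J c ∅ = rectTorusZ Ls J c := by
  unfold rectTorusZtw rectTorusZ
  simp only [Finset.notMem_empty, if_false]

/-- **The character expansion of `Z` on the one-character ray, rectangular torus**:
`Z = Σ_{S ⊆ plaquettes} (2 c_{1/2})^{|S|} I(S)`. [cite: Tomboulis2007Confinement, §6 eqs. (6.2)–(6.4)] -/
theorem rectTorusZ_one_eq_sum (c : ℕ → ℝ) :
    rectTorusZ Ls 1 c = ∑ S ∈ (univ : Finset (RectPlaquette Ls)).powerset, (2 * c 1) ^ S.card * rectCharMoment Ls S := by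
  rw [← rectTorusZtw_empty Ls 1 c, rectTorusZtw_one_eq_sum]
  refine Finset.sum_congr rfl fun S _ => ?_
  rw [Finset.inter_empty, Finset.card_empty, pow_zero, mul_one]

/-! ### The polynomials evaluate to the partition functions and to the census function -/

/-- `oneCharZtwPoly` evaluates at `s` to `Z⁻_V(s)`. -/
theorem oneCharZtwPoly_eval (V : Finset (RectPlaquette Ls)) (s : ℝ) :
    (oneCharZtwPoly Ls V).eval s = oneCharZtw Ls V s := by
  unfold oneCharZtwPoly oneCharZtw
  rw [rectTorusZtw_one_eq_sum, eval_finsetSum]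
  refine Finset.sum_congr rfl fun S _ => ?_
  rw [eval_mul, eval_C, eval_pow, eval_X, oneCharCoeff, mul_pow]
  ring

/-- `oneCharZPoly` evaluates at `s` to `Z(s)`. -/
theorem oneCharZPoly_eval (s : ℝ) : (oneCharZPoly Ls).eval s = oneCharZ Ls s := by
  unfold oneCharZPoly oneCharZ
  rw [rectTorusZ_one_eq_sum, eval_finsetSum]
  refine Finset.sum_congr rfl fun S _ => ?_
  rw [eval_mul, eval_C, eval_pow, eval_X, oneCharCoeff, mul_pow]
  ring

/-- `s ↦ Z⁻_V(s)` is the polynomial function `oneCharZtwPoly`. -/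
theorem oneCharZtw_eq_eval (V : Finset (RectPlaquette Ls)) :
    oneCharZtw Ls V = fun s => (oneCharZtwPoly Ls V).eval s :=
  funext fun s => (oneCharZtwPoly_eval Ls V s).symm

/-- `s ↦ Z(s)` is the polynomial function `oneCharZPoly`. -/
theorem oneCharZ_eq_eval : oneCharZ Ls = fun s => (oneCharZPoly Ls).eval s :=
  funext fun s => (oneCharZPoly_eval Ls s).symm

/-- **The census polynomial evaluates to the census function**: `N_V(s) = twistCensusPoly.eval s` for every real `s`
(so every exact statement about `twistCensusPoly` — lowest term, degree, leading sign, positive roots — is a statement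
about the derivative of the vortex free-energy ratio `Z⁻_V/Z` along the one-character ray). -/
theorem twistCensusPoly_eval (V : Finset (RectPlaquette Ls)) (s : ℝ) :
    (twistCensusPoly Ls V).eval s = oneCharN Ls V s := by
  have h1 : deriv (oneCharZtw Ls V) s = (derivative (oneCharZtwPoly Ls V)).eval s := by
    rw [oneCharZtw_eq_eval, Polynomial.deriv]
  have h2 : deriv (oneCharZ Ls) s = (derivative (oneCharZPoly Ls)).eval s := by
    rw [oneCharZ_eq_eval, Polynomial.deriv]
  unfold twistCensusPoly oneCharN
  rw [eval_sub, eval_mul, eval_mul, h1, h2, oneCharZtwPoly_eval, oneCharZPoly_eval]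

end Summit.Ventures.YMGap.Census

end
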